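/-
Copyright: the b2b-balaban T⁴-continuum CRUX team, row NE7b OWNER lineage `t4-ne7b-p1` (gen 134). Project licence.
-/
import Summits.QuantumFields.BalabanUV.T4Continuum.Spine.NE7b.SupPolymerLocalActivityBound
import Summits.QuantumFields.BalabanUV.T4Continuum.Spine.NE7b.SupPolymerActivityExpansion

/-!
# A REGULATED POLYMER-LOCAL PERTURBATION IS A CONVERGENT POLYMER GAS, VOLUME-UNIFORMLY — THE END OF SCOPING-d5's INPUT COLUMN:
# for a finite family `𝒳` of `R`-connected cell sets carrying factors `f_X` measurable in the cells of `X` (the Mayer factors of a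
# polymer-local perturbation `Σ_{X∈𝒳}K_X`), over a finite-range dependent reference process whose family activities obey
# `|M(𝒜)| = |∫∏_{X∈𝒜}f_X dμ| ≤ ∏_{X∈𝒜}ε^{#X}`, and under the ONE smallness `e·ε′·(Δ+1)² ≤ 1∕2`, `ε′ = √ε·e^{2√ε}`:
#   `Z(𝒳) = ∫∏_{X∈𝒳}(1 + f_X)dμ ≠ 0`,  `Z(𝒳) = exp(log Ξ)`,  `‖log Ξ‖ ≤ #(⋃𝒳)·(Δ+1)·2e·ε′`,
#   `‖log Ξ − Σ_{‖𝒞‖<m}Φ^T(𝒞)‖ ≤ e^{−τm}·#(⋃𝒳)(Δ+1)2e^{1+τ}ε′`, and two factor families whose activities agree on the families supported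
# away from `D` have `‖log Ξ − log Ξ'‖ ≤ 2#D(Δ+1)2eε′ — where `Ξ` is (349)'s RESUMMED GAS of connected cell sets (activity `⋃_*M`,
# polymers the unions of touch-connected subfamilies); and for the Gaussian road (`N(0,Γ)`, `Γ ⪯ γ_op·1` of range `ρ`, diagonal `≤ γ`,
# disjoint cells of `≤ v` sites, singletons REGULATED `‖f_{p}‖ ≤ εe^{½κΣ_{cell p}ω²}`, larger sets SUP-small `‖f_X‖ ≤ ε^{#X}`,
# `κγ_op ≤ θ < 1`) the same with `ε ↦ εA^v`, `A = (1−θ)^{−κγ∕(2θ)}`: (348) → (349) → (350)∕(351) → (352) composed BY NAME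
# (row NE7b, node U5c; [folklore])

Cell `pub-balaban`, sub-cell `t4`, spine estimate NE7b (`T4WeightBudget.RelWeightBound`; the cell's OWN estimate — NOT PRINTED in
[Bałaban 1983–89], NOT PROVED).  Crux-route work under `Spine/NE7b/` by the row OWNER (`t4-ne7b-p1` gen 134, file (353)) under FREEZE
(0)'s crux-prover clause, on `g131/records/SCOPING-d5-reentry.md` (2)∕(3c) («first file: a regulated polymer-local perturbation of the
road's step is again a convergent polymer gas») and § [NE7bP1-G131-ADDENDUM] NEXT (3)(a)(ii); NOTHING of Bałaban's is named as a Lean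
object, valued or asserted; no `T4Continuum/Support` leaf typed; no `def`, no notation; zero `sorry`.  Imports (BY NAME): the OWNER's (351)
`…SupPolymerLocalActivityBound` (`norm_setActivity_le_singletons`, `norm_prod_le_of_letters`) and through it (350) (`abs_pushforwardActivity_le`),
(349) (`polymerLocal_resummation`, `image_biUnion_subset_rconn`), (348) (`setPertZ_eq_polymerPartitionFunction`, `le_of_sets`), (289)
(`one_le_regulatorCost`), (288) (`integrable_exp_half_sq_on`), (287) (`act_measurable_prod`), (276) (`gaussian_indep_of_not_touches`);
(352) `…SupPolymerActivityExpansion` (`ne_zero`, `exp_polymerLogZ`, `norm_polymerLogZ_le`, `norm_polymerLogZ_sub_smallClusters_le`,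
`norm_polymerLogZ_sub_le_of_agree`); the tree's `pertZ`, `cellActivity`, `rconnSubsets`, `pushforwardActivity(_apply, _eq_zero_of_not_mem_image)`,
`polymerPartitionFunction`, `polymerLogZ`, `truncatedWeight`, `Touches`, `GeomInc`, `IsRConnected`, `HasFiniteRange`.

WHY (located).  SCOPING-d5 found the road's input class NOT closed under the step: the output `W⁺ = −log Z` is a POLYMER-LOCAL functional
`Σ_X K_X(ψ|_X)`.  (348)–(351) carried the polymer-local INPUT to (287)'s format (set-indexed polymer representation, resummation by unions to a
gas of connected cell sets, the cover-counting smallness `ε′^{#Y}` of the resummed activity, the activity letter from factor letters) and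
(352) recorded the whole Kotecký–Preiss layer for an abstract activity on any polymer family.  This file composes them: the polymer-local
class enjoys EVERY conclusion the one-site class had in (289)∕(296)∕(311)∕(312) — zero-freeness, the KP logarithm, `O(ε′)` extensivity
uniformly in the volume, the local expansion with exponentially rare large clusters, and locality in the factors.

WHAT IS PROVED ([folklore]; `z := ⋃_*M` on `L := (𝒫^{Touches R}(𝒳)).image ⋃`, `ε′ = √ε·e^{2√ε}`):
* §1 the resummed activity meets (352)'s hypotheses: `letters_of_smallness` (`e·ε′(Δ+1)² ≤ 1∕2 ⟹ (Δ+1)²√ε ≤ 1∕2 ∧ ε ≤ 1`), `eps'_nonneg`,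
  **`pushforward_eq_zero_of_not_rconn`** (`hz0`, by (349)), `pushforward_congr_of_agree` (activities agreeing on the families with union
  `Y` give the same `z Y`);
* §2 abstract measure level (cell σ-algebras `𝓕_p ≤ mΩ` independent across non-touching cell sets, set factors measurable in `⨆_{p∈X}𝓕_p`
  with integrable products, `|M(𝒜)| ≤ ∏ε^{#X}` on `𝒜 ⊆ 𝒳`): **`setPertZ_eq_resummedGas`** ((348)+(349)), **`setPertZ_ne_zero`**,
  **`exp_setLogZ`** (`exp(log Ξ(L; z)) = Z(𝒳)`), **`norm_setLogZ_le`** (`‖log Ξ‖ ≤ #(⋃𝒳)(Δ+1)2eε′`), **`norm_setLogZ_sub_smallClusters_le`**,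
  **`norm_setLogZ_sub_le_of_agree`**;
* §3 THE GAUSSIAN ROAD: `gaussian_set_hypotheses` (the §2 hypotheses for `N(0,Γ)` with cell σ-algebras `σ(ω|_{cell p})`, finite range ⟹
  independence (276), singletons regulated + larger sets sup-small ⟹ integrable products and `|M(𝒜)| ≤ ∏(εA^v)^{#X}` (351)), THE END
  **`gaussian_setPertZ_ne_zero`**, **`gaussian_exp_setLogZ`**, **`gaussian_norm_setLogZ_le`** (`‖log Ξ‖ ≤ #(⋃𝒳)(Δ+1)2e·ε′(εA^v)`); §4 toy.

HONEST (what this is NOT).  Composition only; the OUTPUT in the same format (the cluster sum regrouped by support, `W⁺ = Σ_Y K⁺_Y` with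
`‖K⁺_Y‖ ≲ ε′e^{−τ#Y}`) is the successor file; the exclusion cost for sub-FAMILIES of `𝒳` (needs the fibre comparison `⋃_*M_{𝒳'} = ⋃_*M_𝒳` on
polymers avoiding `D`) is not typed here; the regulated letter is taken on SINGLETONS only ((351)'s honest limit: overlapping regulated members
would pile regulators on shared cells); scalar skeleton ((A3), NC-NE7b-α UNRULED); nothing of Bałaban's asserted.  BY-NAME EFFECT ON THE WALL:
NONE.  NE7b NOT PRINTED ∕ NOT PROVED; spine PROVED 0∕9; rung (B)+1 — the programme's measures remain FINITE-torus statements; NOT the mass gap,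
NOT Clay.  HONEST DEPENDENCY: continuum YM on T⁴ ⇐ BetaPertH ∧ nine spine estimates (0∕9 proved); BetaPertH ⇐ (D1) ∧ (D4) ∧ CAP+tail;
G-an2-4 gates asym, D1 and NE2∕3∕4.
-/

set_option autoImplicit false

noncomputable section

namespace Summit.QuantumFields.BalabanUV.T4Continuum.NE7b.SupPolymerLocalExpansion

open MeasureTheory ProbabilityTheory Finset Real
open scoped BigOperators
open Literature.Probability.LatticeModels
open Literature.Analysis.Matrix (HasFiniteRange)
open SupPolymerLocalGas (setPertZ_eq_polymerPartitionFunction le_of_sets)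
open SupPolymerLocalResummation (polymerLocal_resummation image_biUnion_subset_rconn)
open SupPolymerLocalSmallness (abs_pushforwardActivity_le)
open SupPolymerLocalActivityBound (norm_setActivity_le_singletons norm_prod_le_of_letters)
open SupRegulatedActivityBound (one_le_regulatorCost)
open SupGaussianRegulator (integrable_exp_half_sq_on)
open SupGaussianFiniteRangeDependence (gaussian_indep_of_not_touches)
open SupActivityPolymerGas (act_measurable_prod)

variable {V : Type*} [DecidableEq V] {R : V → V → Prop} [DecidableRel R] {nbr : V → Finset V} {Δ : ℕ}

/-! ## §1. The resummed activity meets the abstract hypotheses -/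

/-- **One smallness gives the letters of (350)**: `e·(√ε·e^{2√ε})·(Δ+1)² ≤ 1∕2 ⟹ (Δ+1)²√ε ≤ 1∕2` and `ε ≤ 1`. [folklore] -/
theorem letters_of_smallness {ε : ℝ}
    (hsmall : Real.exp 1 * (Real.sqrt ε * Real.exp (2 * Real.sqrt ε)) * ((Δ : ℝ) + 1) ^ 2 ≤ 1 / 2) :
    ((Δ : ℝ) + 1) ^ 2 * Real.sqrt ε ≤ 1 / 2 ∧ ε ≤ 1 := by
  have hs0 : 0 ≤ Real.sqrt ε := Real.sqrt_nonneg ε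
  have hΔ1 : (1 : ℝ) ≤ ((Δ : ℝ) + 1) ^ 2 := by
    have : (0 : ℝ) ≤ Δ := Nat.cast_nonneg Δ
    nlinarith
  have hee : 1 ≤ Real.exp 1 * Real.exp (2 * Real.sqrt ε) :=
    one_le_mul_of_one_le_of_one_le (Real.one_le_exp zero_le_one) (Real.one_le_exp (by positivity))
  have h1 : ((Δ : ℝ) + 1) ^ 2 * Real.sqrt ε ≤ 1 / 2 := by
    calc ((Δ : ℝ) + 1) ^ 2 * Real.sqrt ε ≤ ((Δ : ℝ) + 1) ^ 2 * Real.sqrt ε * (Real.exp 1 * Real.exp (2 * Real.sqrt ε)) :=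
          le_mul_of_one_le_right (by positivity) hee
      _ = Real.exp 1 * (Real.sqrt ε * Real.exp (2 * Real.sqrt ε)) * ((Δ : ℝ) + 1) ^ 2 := by ring
      _ ≤ 1 / 2 := hsmall
  refine ⟨h1, Real.sqrt_le_one.1 ?_⟩
  calc Real.sqrt ε ≤ ((Δ : ℝ) + 1) ^ 2 * Real.sqrt ε := le_mul_of_one_le_left hs0 hΔ1
    _ ≤ 1 / 2 := h1
    _ ≤ 1 := by norm_num

/-- `0 ≤ ε′ = √ε·e^{2√ε}`. [folklore] -/
theorem eps'_nonneg (ε : ℝ) : 0 ≤ Real.sqrt ε * Real.exp (2 * Real.sqrt ε) := by positivity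

/-- **`hz0` FOR THE RESUMMED ACTIVITY**: members of `𝒳` `R`-connected ⟹ `(⋃_*M)(Y) = 0` for every `Y` that is not `R`-connected (by (349) every
polymer of the image is `R`-connected). [folklore] -/
theorem pushforward_eq_zero_of_not_rconn (𝒳 : Finset (Finset V)) (hconn : ∀ X ∈ 𝒳, IsRConnected R X) (M : Finset (Finset V) → ℂ)
    (Y : Finset V) (hY : ¬ IsRConnected R Y) :
    pushforwardActivity (fun 𝒜 : Finset (Finset V) => 𝒜.biUnion id) M (rconnSubsets (Touches R) 𝒳) Y = 0 :=
  pushforwardActivity_eq_zero_of_not_mem_image fun hYim => hY (mem_rconnSubsets.1 (image_biUnion_subset_rconn 𝒳 hconn hYim)).2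

omit [DecidableRel R] in
/-- **Activities agreeing on the families with union `Y` give the same resummed activity at `Y`.** [folklore] -/
theorem pushforward_congr_of_agree {M M' : Finset (Finset V) → ℂ} (𝒳 : Finset (Finset V)) (Y : Finset V)
    (hagree : ∀ 𝒜, 𝒜 ⊆ 𝒳 → 𝒜.biUnion id = Y → M 𝒜 = M' 𝒜) :
    pushforwardActivity (fun 𝒜 : Finset (Finset V) => 𝒜.biUnion id) M (rconnSubsets (Touches R) 𝒳) Y =
      pushforwardActivity (fun 𝒜 : Finset (Finset V) => 𝒜.biUnion id) M' (rconnSubsets (Touches R) 𝒳) Y := by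
  rw [pushforwardActivity_apply, pushforwardActivity_apply]
  refine sum_congr rfl fun 𝒜 h𝒜 => ?_
  obtain ⟨h𝒜P, hU⟩ := mem_filter.1 h𝒜
  exact hagree 𝒜 (mem_rconnSubsets.1 h𝒜P).1 hU

/-! ## §2. Abstract measure level: the polymer-local gas is convergent -/

section Measure

variable {Ω : Type*} {mΩ : MeasurableSpace Ω} {μ : Measure Ω} {𝓕 : V → MeasurableSpace Ω} {f f' : Finset V → Ω → ℂ} {ε : ℝ}

/-- **`Z(𝒳)` IS THE RESUMMED GAS OF CONNECTED CELL SETS** ((348) then (349)): `R` symmetric, cell σ-algebras `𝓕_p ≤ mΩ` independent across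
non-touching cell sets, set factors measurable in `⨆_{p∈X}𝓕_p` with integrable products, members of `𝒳` `R`-connected ⟹
`∫∏_{X∈𝒳}(1 + f_X)dμ = Ξ^{GeomInc R}(L; ⋃_*M)`. [folklore] -/
theorem setPertZ_eq_resummedGas [IsProbabilityMeasure μ] (hR : ∀ x y, R x y → R y x) (hle : ∀ p, 𝓕 p ≤ mΩ)
    (hindep : ∀ K₁ K₂ : Finset V, ¬ Touches R K₁ K₂ → Indep (⨆ p ∈ K₁, 𝓕 p) (⨆ p ∈ K₂, 𝓕 p) μ)
    (hmeas : ∀ X, Measurable[⨆ p ∈ X, 𝓕 p] (f X)) (hint : ∀ 𝒜 : Finset (Finset V), Integrable (fun ω => ∏ X ∈ 𝒜, f X ω) μ)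
    (𝒳 : Finset (Finset V)) (hconn : ∀ X ∈ 𝒳, IsRConnected R X) :
    pertZ μ f 𝒳 = polymerPartitionFunction (GeomInc R)
      (pushforwardActivity (fun 𝒜 : Finset (Finset V) => 𝒜.biUnion id) (cellActivity μ f) (rconnSubsets (Touches R) 𝒳))
      ((rconnSubsets (Touches R) 𝒳).image fun 𝒜 => 𝒜.biUnion id) := by
  haveI : Std.Symm R := ⟨hR⟩
  rw [setPertZ_eq_polymerPartitionFunction hR hle hindep hmeas hint 𝒳]
  exact polymerLocal_resummation 𝒳 (fun X hX => (hconn X hX).1) _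

/-- **ZERO-FREENESS OF THE POLYMER-LOCAL GAS**: in addition `R` with `≤ Δ` neighbours, `0 ≤ ε`, `|M(𝒜)| ≤ ∏_{X∈𝒜}ε^{#X}` for `𝒜 ⊆ 𝒳`, and
`e·ε′·(Δ+1)² ≤ 1∕2` (`ε′ = √ε·e^{2√ε}`) ⟹ `∫∏_{X∈𝒳}(1 + f_X)dμ ≠ 0`. [folklore] -/
theorem setPertZ_ne_zero [IsProbabilityMeasure μ] (hR : ∀ x y, R x y → R y x) (hΔ : ∀ x, (nbr x).card ≤ Δ)
    (hnbr : ∀ x y, R x y → y ∈ nbr x) (hle : ∀ p, 𝓕 p ≤ mΩ)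
    (hindep : ∀ K₁ K₂ : Finset V, ¬ Touches R K₁ K₂ → Indep (⨆ p ∈ K₁, 𝓕 p) (⨆ p ∈ K₂, 𝓕 p) μ)
    (hmeas : ∀ X, Measurable[⨆ p ∈ X, 𝓕 p] (f X)) (hint : ∀ 𝒜 : Finset (Finset V), Integrable (fun ω => ∏ X ∈ 𝒜, f X ω) μ)
    (𝒳 : Finset (Finset V)) (hconn : ∀ X ∈ 𝒳, IsRConnected R X) (hε : 0 ≤ ε)
    (hM : ∀ 𝒜, 𝒜 ⊆ 𝒳 → ‖cellActivity μ f 𝒜‖ ≤ ∏ X ∈ 𝒜, ε ^ X.card)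
    (hsmall : Real.exp 1 * (Real.sqrt ε * Real.exp (2 * Real.sqrt ε)) * ((Δ : ℝ) + 1) ^ 2 ≤ 1 / 2) : pertZ μ f 𝒳 ≠ 0 := by
  obtain ⟨hs1, hε1⟩ := letters_of_smallness hsmall
  rw [setPertZ_eq_resummedGas hR hle hindep hmeas hint 𝒳 hconn]
  exact SupPolymerActivityExpansion.ne_zero hR hΔ hnbr (pushforward_eq_zero_of_not_rconn 𝒳 hconn _)
    (abs_pushforwardActivity_le hR hΔ hnbr 𝒳 hconn hε hε1 hM hs1) (eps'_nonneg ε) hsmall _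

/-- **THE KP LOGARITHM OF THE POLYMER-LOCAL GAS**: `exp(log Ξ(L; ⋃_*M)) = ∫∏_{X∈𝒳}(1 + f_X)dμ`. [folklore] -/
theorem exp_setLogZ [IsProbabilityMeasure μ] (hR : ∀ x y, R x y → R y x) (hΔ : ∀ x, (nbr x).card ≤ Δ)
    (hnbr : ∀ x y, R x y → y ∈ nbr x) (hle : ∀ p, 𝓕 p ≤ mΩ)
    (hindep : ∀ K₁ K₂ : Finset V, ¬ Touches R K₁ K₂ → Indep (⨆ p ∈ K₁, 𝓕 p) (⨆ p ∈ K₂, 𝓕 p) μ)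
    (hmeas : ∀ X, Measurable[⨆ p ∈ X, 𝓕 p] (f X)) (hint : ∀ 𝒜 : Finset (Finset V), Integrable (fun ω => ∏ X ∈ 𝒜, f X ω) μ)
    (𝒳 : Finset (Finset V)) (hconn : ∀ X ∈ 𝒳, IsRConnected R X) (hε : 0 ≤ ε)
    (hM : ∀ 𝒜, 𝒜 ⊆ 𝒳 → ‖cellActivity μ f 𝒜‖ ≤ ∏ X ∈ 𝒜, ε ^ X.card)
    (hsmall : Real.exp 1 * (Real.sqrt ε * Real.exp (2 * Real.sqrt ε)) * ((Δ : ℝ) + 1) ^ 2 ≤ 1 / 2) :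
    Complex.exp (polymerLogZ (GeomInc R)
        (pushforwardActivity (fun 𝒜 : Finset (Finset V) => 𝒜.biUnion id) (cellActivity μ f) (rconnSubsets (Touches R) 𝒳))
        ((rconnSubsets (Touches R) 𝒳).image fun 𝒜 => 𝒜.biUnion id)) = pertZ μ f 𝒳 := by
  haveI : Std.Symm R := ⟨hR⟩
  obtain ⟨hs1, hε1⟩ := letters_of_smallness hsmall
  rw [setPertZ_eq_resummedGas hR hle hindep hmeas hint 𝒳 hconn]
  exact SupPolymerActivityExpansion.exp_polymerLogZ hΔ hnbr (pushforward_eq_zero_of_not_rconn 𝒳 hconn _)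
    (abs_pushforwardActivity_le hR hΔ hnbr 𝒳 hconn hε hε1 hM hs1) (eps'_nonneg ε) hsmall _

/-- **EXTENSIVITY OF THE POLYMER-LOCAL GAS WITH AN `O(ε′)` DENSITY, UNIFORMLY IN THE VOLUME**: `‖log Ξ(L; ⋃_*M)‖ ≤ #(⋃𝒳)·(Δ+1)·2e·ε′` (no
measure-theoretic hypothesis: the activity letter alone). [folklore] -/
theorem norm_setLogZ_le (hR : ∀ x y, R x y → R y x) (hΔ : ∀ x, (nbr x).card ≤ Δ) (hnbr : ∀ x y, R x y → y ∈ nbr x)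
    (𝒳 : Finset (Finset V)) (hconn : ∀ X ∈ 𝒳, IsRConnected R X) (hε : 0 ≤ ε)
    (hM : ∀ 𝒜, 𝒜 ⊆ 𝒳 → ‖cellActivity μ f 𝒜‖ ≤ ∏ X ∈ 𝒜, ε ^ X.card)
    (hsmall : Real.exp 1 * (Real.sqrt ε * Real.exp (2 * Real.sqrt ε)) * ((Δ : ℝ) + 1) ^ 2 ≤ 1 / 2) :
    ‖polymerLogZ (GeomInc R)
        (pushforwardActivity (fun 𝒜 : Finset (Finset V) => 𝒜.biUnion id) (cellActivity μ f) (rconnSubsets (Touches R) 𝒳))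
        ((rconnSubsets (Touches R) 𝒳).image fun 𝒜 => 𝒜.biUnion id)‖ ≤
      (𝒳.biUnion id).card * ((Δ : ℝ) + 1) * (2 * (Real.exp 1 * (Real.sqrt ε * Real.exp (2 * Real.sqrt ε)))) := by
  obtain ⟨hs1, hε1⟩ := letters_of_smallness hsmall
  exact SupPolymerActivityExpansion.norm_polymerLogZ_le hR hΔ hnbr (pushforward_eq_zero_of_not_rconn 𝒳 hconn _)
    (abs_pushforwardActivity_le hR hΔ hnbr 𝒳 hconn hε hε1 hM hs1) (eps'_nonneg ε) hsmall (image_biUnion_subset_rconn 𝒳 hconn)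

/-- **THE LOCAL EXPANSION OF THE POLYMER-LOCAL GAS**: `0 ≤ τ`, `e^{1+τ}ε′(Δ+1)² ≤ 1∕2`, `0 < m` ⟹
`‖log Ξ(L; ⋃_*M) − Σ_{𝒞 ⊆ L, ‖𝒞‖ < m}Φ^T(𝒞)‖ ≤ e^{−τm}·#(⋃𝒳)(Δ+1)2e^{1+τ}ε′`. [folklore] -/
theorem norm_setLogZ_sub_smallClusters_le (hR : ∀ x y, R x y → R y x) (hΔ : ∀ x, (nbr x).card ≤ Δ)
    (hnbr : ∀ x y, R x y → y ∈ nbr x) (𝒳 : Finset (Finset V)) (hconn : ∀ X ∈ 𝒳, IsRConnected R X) (hε : 0 ≤ ε)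
    (hM : ∀ 𝒜, 𝒜 ⊆ 𝒳 → ‖cellActivity μ f 𝒜‖ ≤ ∏ X ∈ 𝒜, ε ^ X.card) {τ : ℝ} (hτ : 0 ≤ τ)
    (hsmall : Real.exp (1 + τ) * (Real.sqrt ε * Real.exp (2 * Real.sqrt ε)) * ((Δ : ℝ) + 1) ^ 2 ≤ 1 / 2) {m : ℝ} (hm : 0 < m) :
    ‖polymerLogZ (GeomInc R)
          (pushforwardActivity (fun 𝒜 : Finset (Finset V) => 𝒜.biUnion id) (cellActivity μ f) (rconnSubsets (Touches R) 𝒳))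
          ((rconnSubsets (Touches R) 𝒳).image fun 𝒜 => 𝒜.biUnion id) -
        ∑ 𝒞 ∈ ((rconnSubsets (Touches R) 𝒳).image fun 𝒜 => 𝒜.biUnion id).powerset with ∑ Y ∈ 𝒞, (Y.card : ℝ) < m,
          truncatedWeight (GeomInc R)
            (pushforwardActivity (fun 𝒜 : Finset (Finset V) => 𝒜.biUnion id) (cellActivity μ f) (rconnSubsets (Touches R) 𝒳)) 𝒞‖ ≤
      Real.exp (-(τ * m)) * ((𝒳.biUnion id).card * ((Δ : ℝ) + 1) * (2 * (Real.exp (1 + τ) * (Real.sqrt ε * Real.exp (2 * Real.sqrt ε))))) := by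
  obtain ⟨hs1, hε1⟩ := letters_of_smallness (Δ := Δ)
    (SupEffectiveActionLocalExpansion.smallness_of_decay (eps'_nonneg ε) hτ hsmall)
  exact SupPolymerActivityExpansion.norm_polymerLogZ_sub_smallClusters_le hR hΔ hnbr (pushforward_eq_zero_of_not_rconn 𝒳 hconn _)
    (abs_pushforwardActivity_le hR hΔ hnbr 𝒳 hconn hε hε1 hM hs1) (eps'_nonneg ε) hτ hsmall (image_biUnion_subset_rconn 𝒳 hconn) hm

/-- **LOCALITY OF THE POLYMER-LOCAL GAS IN ITS FACTORS**: two factor families with the activity letter whose activities AGREE on the families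
`𝒜 ⊆ 𝒳` supported away from `D` (`⋃𝒜 ∩ D = ∅`) ⟹ `‖log Ξ(L; ⋃_*M) − log Ξ(L; ⋃_*M')‖ ≤ 2·#D·(Δ+1)·2e·ε′`, uniformly in the volume. [folklore] -/
theorem norm_setLogZ_sub_le_of_agree (hR : ∀ x y, R x y → R y x) (hΔ : ∀ x, (nbr x).card ≤ Δ)
    (hnbr : ∀ x y, R x y → y ∈ nbr x) (𝒳 : Finset (Finset V)) (hconn : ∀ X ∈ 𝒳, IsRConnected R X) (hε : 0 ≤ ε)
    (hM : ∀ 𝒜, 𝒜 ⊆ 𝒳 → ‖cellActivity μ f 𝒜‖ ≤ ∏ X ∈ 𝒜, ε ^ X.card)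
    (hM' : ∀ 𝒜, 𝒜 ⊆ 𝒳 → ‖cellActivity μ f' 𝒜‖ ≤ ∏ X ∈ 𝒜, ε ^ X.card)
    (hsmall : Real.exp 1 * (Real.sqrt ε * Real.exp (2 * Real.sqrt ε)) * ((Δ : ℝ) + 1) ^ 2 ≤ 1 / 2) (D : Finset V)
    (hagree : ∀ 𝒜, 𝒜 ⊆ 𝒳 → Disjoint (𝒜.biUnion id) D → cellActivity μ f 𝒜 = cellActivity μ f' 𝒜) :
    ‖polymerLogZ (GeomInc R)
          (pushforwardActivity (fun 𝒜 : Finset (Finset V) => 𝒜.biUnion id) (cellActivity μ f) (rconnSubsets (Touches R) 𝒳))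
          ((rconnSubsets (Touches R) 𝒳).image fun 𝒜 => 𝒜.biUnion id) -
        polymerLogZ (GeomInc R)
          (pushforwardActivity (fun 𝒜 : Finset (Finset V) => 𝒜.biUnion id) (cellActivity μ f') (rconnSubsets (Touches R) 𝒳))
          ((rconnSubsets (Touches R) 𝒳).image fun 𝒜 => 𝒜.biUnion id)‖ ≤
      2 * (D.card * ((Δ : ℝ) + 1) * (2 * (Real.exp 1 * (Real.sqrt ε * Real.exp (2 * Real.sqrt ε))))) := by
  obtain ⟨hs1, hε1⟩ := letters_of_smallness hsmall
  refine SupPolymerActivityExpansion.norm_polymerLogZ_sub_le_of_agree hR hΔ hnbr (pushforward_eq_zero_of_not_rconn 𝒳 hconn _)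
    (abs_pushforwardActivity_le hR hΔ hnbr 𝒳 hconn hε hε1 hM hs1) (pushforward_eq_zero_of_not_rconn 𝒳 hconn _)
    (abs_pushforwardActivity_le hR hΔ hnbr 𝒳 hconn hε hε1 hM' hs1) (eps'_nonneg ε) hsmall _ D fun Y _ hYD => ?_
  exact pushforward_congr_of_agree 𝒳 Y fun 𝒜 h𝒜 hU => hagree 𝒜 h𝒜 (hU ▸ hYD)

end Measure

/-! ## §3. THE GAUSSIAN ROAD: singletons regulated, larger sets sup-small -/

section Gaussian

variable {ι : Type} [Fintype ι] [DecidableEq ι]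

omit [DecidableRel R] in
/-- **THE HYPOTHESES OF §2 FOR THE GAUSSIAN ROAD.**  `Γ ⪰ 0` of range `ρ`, `Γ ⪯ γ_op·1`, diagonal `≤ γ` (`γ ≥ 0`); disjoint cells of `≤ v` sites
with an adjacency `R` covering `ρ`-closeness; set factors measurable in the cells of their set; singletons regulated
(`‖f_X(ω)‖ ≤ ε^{#X}e^{½κΣ_{cells X}ω²}` for `#X = 1`), the other sets sup-small (`‖f_X‖ ≤ ε^{#X}`); `0 ≤ ε`, `0 ≤ κ`, `0 < θ < 1`, `κγ_op ≤ θ` ⟹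
cell σ-algebras `≤` the Borel one, independence across non-touching cell sets, integrable products, and the activity letter
`|M(𝒜)| ≤ ∏_{X∈𝒜}(εA^v)^{#X}` for EVERY family, `A = (1−θ)^{−κγ∕(2θ)}`, with `0 ≤ εA^v`. [folklore] -/
theorem gaussian_set_hypotheses {Γ : Matrix ι ι ℝ} {γop γ : ℝ} (hΓ : Γ.PosSemidef) (hΓop : (γop • (1 : Matrix ι ι ℝ) - Γ).PosSemidef)
    (hdiag : ∀ i, Γ i i ≤ γ) (hγ : 0 ≤ γ) {dι : ι → ι → ℕ} {ρ : ℕ} (hfr : HasFiniteRange dι ρ Γ) (cell : V → Finset ι)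
    (hdisj : ∀ p q, p ≠ q → Disjoint (cell p) (cell q)) {v : ℕ} (hv : ∀ p, (cell p).card ≤ v)
    (hR : ∀ (p p' : V) (x y : ι), x ∈ cell p → y ∈ cell p' → dι x y ≤ ρ → p = p' ∨ R p p')
    {f : Finset V → EuclideanSpace ℝ ι → ℂ} {ε κ θ : ℝ} (hε : 0 ≤ ε) (hκ : 0 ≤ κ) (hθ0 : 0 < θ) (hθ1 : θ < 1) (hκθ : κ * γop ≤ θ)
    (hmeas : ∀ X, Measurable[⨆ p ∈ X, MeasurableSpace.comap (fun (ω : EuclideanSpace ℝ ι) (x : cell p) => ω x) inferInstance] (f X))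
    (hreg : ∀ X : Finset V, X.card = 1 → ∀ ω : EuclideanSpace ℝ ι, ‖f X ω‖ ≤ ε ^ X.card * exp (κ * (∑ x ∈ X.biUnion cell, ω x ^ 2) / 2))
    (hsup : ∀ X : Finset V, X.card ≠ 1 → ∀ ω : EuclideanSpace ℝ ι, ‖f X ω‖ ≤ ε ^ X.card) :
    (∀ p, MeasurableSpace.comap (fun (ω : EuclideanSpace ℝ ι) (x : cell p) => ω x) inferInstance ≤
        (inferInstance : MeasurableSpace (EuclideanSpace ℝ ι))) ∧
      (∀ K₁ K₂ : Finset V, ¬ Touches R K₁ K₂ →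
        Indep (⨆ p ∈ K₁, MeasurableSpace.comap (fun (ω : EuclideanSpace ℝ ι) (x : cell p) => ω x) inferInstance)
          (⨆ p ∈ K₂, MeasurableSpace.comap (fun (ω : EuclideanSpace ℝ ι) (x : cell p) => ω x) inferInstance)
          (multivariateGaussian 0 Γ)) ∧
      (∀ 𝒜 : Finset (Finset V), Integrable (fun ω => ∏ X ∈ 𝒜, f X ω) (multivariateGaussian 0 Γ)) ∧
      (∀ 𝒜 : Finset (Finset V), ‖cellActivity (multivariateGaussian 0 Γ) f 𝒜‖ ≤
        ∏ X ∈ 𝒜, (ε * ((1 - θ) ^ (-(κ * γ / (2 * θ)))) ^ v) ^ X.card) ∧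
      0 ≤ ε * ((1 - θ) ^ (-(κ * γ / (2 * θ)))) ^ v := by
  have hle : ∀ p, MeasurableSpace.comap (fun (ω : EuclideanSpace ℝ ι) (x : cell p) => ω x) inferInstance ≤
      (inferInstance : MeasurableSpace (EuclideanSpace ℝ ι)) := fun _ => measurable_iff_comap_le.1 (by fun_prop)
  refine ⟨hle, fun K₁ K₂ hKK => gaussian_indep_of_not_touches hΓ 0 cell hfr hR K₁ K₂ hKK, fun 𝒜 => ?_,
    norm_setActivity_le_singletons hΓ hΓop hdiag hγ cell hdisj hv hε hκ hθ0 hθ1 hκθ hreg hsup,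
    mul_nonneg hε (pow_nonneg (zero_le_one.trans (one_le_regulatorCost (mul_nonneg hκ hγ) hθ0 hθ1)) _)⟩
  -- integrability: split `𝒜` into its singletons (regulated, pairwise disjoint) and the rest (sup-small); dominate by the regulator
  have hsplit : 𝒜.filter (fun X => X.card = 1) ∪ 𝒜.filter (fun X => ¬ X.card = 1) = 𝒜 := filter_union_filter_not_eq _ 𝒜
  have h12 : Disjoint (𝒜.filter (fun X => X.card = 1)) (𝒜.filter (fun X => ¬ X.card = 1)) := disjoint_filter_filter_not 𝒜 𝒜 _
  have hpw : ∀ X ∈ 𝒜.filter (fun X => X.card = 1), ∀ Y ∈ 𝒜.filter (fun X => X.card = 1), X ≠ Y → Disjoint X Y := by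
    intro X hX Y hY hXY
    obtain ⟨a, rfl⟩ := card_eq_one.1 (mem_filter.1 hX).2
    obtain ⟨b, rfl⟩ := card_eq_one.1 (mem_filter.1 hY).2
    rw [disjoint_singleton_left, mem_singleton]
    exact fun hab => hXY (by rw [hab])
  have hpt := norm_prod_le_of_letters cell hdisj hε h12 hpw (fun X hX => hreg X (mem_filter.1 hX).2) (fun X hX => hsup X (mem_filter.1 hX).2)
    (f := f) (κ := κ)
  rw [hsplit] at hpt
  have hmeasprod : Measurable fun ω => ∏ X ∈ 𝒜, f X ω :=
    act_measurable_prod (𝓕 := fun X : Finset V => ⨆ p ∈ X, MeasurableSpace.comap (fun (ω : EuclideanSpace ℝ ι) (x : cell p) => ω x)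
      inferInstance) (fun X => le_of_sets hle X) hmeas 𝒜
  exact Integrable.mono' ((integrable_exp_half_sq_on hΓ hΓop hκ hθ1 hκθ _).const_mul _) hmeasprod.aestronglyMeasurable
    (ae_of_all _ fun ω => hpt ω)

/-- **THE END (i) — A REGULATED POLYMER-LOCAL PERTURBATION OF THE GAUSSIAN ROAD HAS A ZERO-FREE PARTITION FUNCTION**: under the hypotheses of
`gaussian_set_hypotheses`, `R` symmetric and decidable with `≤ Δ` neighbours, members of `𝒳` `R`-connected, and `e·ε′(εA^v)·(Δ+1)² ≤ 1∕2` ⟹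
`∫∏_{X∈𝒳}(1 + f_X)dN(0,Γ) ≠ 0`. [folklore] -/
theorem gaussian_setPertZ_ne_zero {Γ : Matrix ι ι ℝ} {γop γ : ℝ} (hΓ : Γ.PosSemidef) (hΓop : (γop • (1 : Matrix ι ι ℝ) - Γ).PosSemidef)
    (hdiag : ∀ i, Γ i i ≤ γ) (hγ : 0 ≤ γ) {dι : ι → ι → ℕ} {ρ : ℕ} (hfr : HasFiniteRange dι ρ Γ) (cell : V → Finset ι)
    (hdisj : ∀ p q, p ≠ q → Disjoint (cell p) (cell q)) {v : ℕ} (hv : ∀ p, (cell p).card ≤ v) (hRsymm : ∀ x y, R x y → R y x)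
    (hR : ∀ (p p' : V) (x y : ι), x ∈ cell p → y ∈ cell p' → dι x y ≤ ρ → p = p' ∨ R p p')
    (hΔ : ∀ x, (nbr x).card ≤ Δ) (hnbr : ∀ x y, R x y → y ∈ nbr x)
    {f : Finset V → EuclideanSpace ℝ ι → ℂ} {ε κ θ : ℝ} (hε : 0 ≤ ε) (hκ : 0 ≤ κ) (hθ0 : 0 < θ) (hθ1 : θ < 1) (hκθ : κ * γop ≤ θ)
    (hmeas : ∀ X, Measurable[⨆ p ∈ X, MeasurableSpace.comap (fun (ω : EuclideanSpace ℝ ι) (x : cell p) => ω x) inferInstance] (f X))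
    (hreg : ∀ X : Finset V, X.card = 1 → ∀ ω : EuclideanSpace ℝ ι, ‖f X ω‖ ≤ ε ^ X.card * exp (κ * (∑ x ∈ X.biUnion cell, ω x ^ 2) / 2))
    (hsup : ∀ X : Finset V, X.card ≠ 1 → ∀ ω : EuclideanSpace ℝ ι, ‖f X ω‖ ≤ ε ^ X.card) (𝒳 : Finset (Finset V))
    (hconn : ∀ X ∈ 𝒳, IsRConnected R X)
    (hsmall : Real.exp 1 * (Real.sqrt (ε * ((1 - θ) ^ (-(κ * γ / (2 * θ)))) ^ v) *
      Real.exp (2 * Real.sqrt (ε * ((1 - θ) ^ (-(κ * γ / (2 * θ)))) ^ v))) * ((Δ : ℝ) + 1) ^ 2 ≤ 1 / 2) :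
    pertZ (multivariateGaussian 0 Γ) f 𝒳 ≠ 0 := by
  obtain ⟨hle, hindep, hint, hM, hε'⟩ :=
    gaussian_set_hypotheses hΓ hΓop hdiag hγ hfr cell hdisj hv hR hε hκ hθ0 hθ1 hκθ hmeas hreg hsup
  exact setPertZ_ne_zero hRsymm hΔ hnbr hle hindep hmeas hint 𝒳 hconn hε' (fun 𝒜 _ => hM 𝒜) hsmall

/-- **THE END (ii) — ITS KP LOGARITHM**: `exp(log Ξ(L; ⋃_*M)) = ∫∏_{X∈𝒳}(1 + f_X)dN(0,Γ)`. [folklore] -/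
theorem gaussian_exp_setLogZ {Γ : Matrix ι ι ℝ} {γop γ : ℝ} (hΓ : Γ.PosSemidef) (hΓop : (γop • (1 : Matrix ι ι ℝ) - Γ).PosSemidef)
    (hdiag : ∀ i, Γ i i ≤ γ) (hγ : 0 ≤ γ) {dι : ι → ι → ℕ} {ρ : ℕ} (hfr : HasFiniteRange dι ρ Γ) (cell : V → Finset ι)
    (hdisj : ∀ p q, p ≠ q → Disjoint (cell p) (cell q)) {v : ℕ} (hv : ∀ p, (cell p).card ≤ v) (hRsymm : ∀ x y, R x y → R y x)
    (hR : ∀ (p p' : V) (x y : ι), x ∈ cell p → y ∈ cell p' → dι x y ≤ ρ → p = p' ∨ R p p')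
    (hΔ : ∀ x, (nbr x).card ≤ Δ) (hnbr : ∀ x y, R x y → y ∈ nbr x)
    {f : Finset V → EuclideanSpace ℝ ι → ℂ} {ε κ θ : ℝ} (hε : 0 ≤ ε) (hκ : 0 ≤ κ) (hθ0 : 0 < θ) (hθ1 : θ < 1) (hκθ : κ * γop ≤ θ)
    (hmeas : ∀ X, Measurable[⨆ p ∈ X, MeasurableSpace.comap (fun (ω : EuclideanSpace ℝ ι) (x : cell p) => ω x) inferInstance] (f X))
    (hreg : ∀ X : Finset V, X.card = 1 → ∀ ω : EuclideanSpace ℝ ι, ‖f X ω‖ ≤ ε ^ X.card * exp (κ * (∑ x ∈ X.biUnion cell, ω x ^ 2) / 2))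
    (hsup : ∀ X : Finset V, X.card ≠ 1 → ∀ ω : EuclideanSpace ℝ ι, ‖f X ω‖ ≤ ε ^ X.card) (𝒳 : Finset (Finset V))
    (hconn : ∀ X ∈ 𝒳, IsRConnected R X)
    (hsmall : Real.exp 1 * (Real.sqrt (ε * ((1 - θ) ^ (-(κ * γ / (2 * θ)))) ^ v) *
      Real.exp (2 * Real.sqrt (ε * ((1 - θ) ^ (-(κ * γ / (2 * θ)))) ^ v))) * ((Δ : ℝ) + 1) ^ 2 ≤ 1 / 2) :
    Complex.exp (polymerLogZ (GeomInc R)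
        (pushforwardActivity (fun 𝒜 : Finset (Finset V) => 𝒜.biUnion id) (cellActivity (multivariateGaussian 0 Γ) f)
          (rconnSubsets (Touches R) 𝒳))
        ((rconnSubsets (Touches R) 𝒳).image fun 𝒜 => 𝒜.biUnion id)) = pertZ (multivariateGaussian 0 Γ) f 𝒳 := by
  obtain ⟨hle, hindep, hint, hM, hε'⟩ :=
    gaussian_set_hypotheses hΓ hΓop hdiag hγ hfr cell hdisj hv hR hε hκ hθ0 hθ1 hκθ hmeas hreg hsup
  exact exp_setLogZ hRsymm hΔ hnbr hle hindep hmeas hint 𝒳 hconn hε' (fun 𝒜 _ => hM 𝒜) hsmall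

/-- **THE END (iii) — EXTENSIVITY WITH AN `O(ε′)` DENSITY, UNIFORMLY IN THE VOLUME**: singletons regulated, larger sets sup-small (NO measurability,
NO range needed) ⟹ `‖log Ξ(L; ⋃_*M)‖ ≤ #(⋃𝒳)·(Δ+1)·2e·ε′`, `ε′ = √(εA^v)·e^{2√(εA^v)}`. [folklore] -/
theorem gaussian_norm_setLogZ_le {Γ : Matrix ι ι ℝ} {γop γ : ℝ} (hΓ : Γ.PosSemidef) (hΓop : (γop • (1 : Matrix ι ι ℝ) - Γ).PosSemidef)
    (hdiag : ∀ i, Γ i i ≤ γ) (hγ : 0 ≤ γ) (cell : V → Finset ι) (hdisj : ∀ p q, p ≠ q → Disjoint (cell p) (cell q)) {v : ℕ}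
    (hv : ∀ p, (cell p).card ≤ v) (hRsymm : ∀ x y, R x y → R y x) (hΔ : ∀ x, (nbr x).card ≤ Δ) (hnbr : ∀ x y, R x y → y ∈ nbr x)
    {f : Finset V → EuclideanSpace ℝ ι → ℂ} {ε κ θ : ℝ} (hε : 0 ≤ ε) (hκ : 0 ≤ κ) (hθ0 : 0 < θ) (hθ1 : θ < 1) (hκθ : κ * γop ≤ θ)
    (hreg : ∀ X : Finset V, X.card = 1 → ∀ ω : EuclideanSpace ℝ ι, ‖f X ω‖ ≤ ε ^ X.card * exp (κ * (∑ x ∈ X.biUnion cell, ω x ^ 2) / 2))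
    (hsup : ∀ X : Finset V, X.card ≠ 1 → ∀ ω : EuclideanSpace ℝ ι, ‖f X ω‖ ≤ ε ^ X.card) (𝒳 : Finset (Finset V))
    (hconn : ∀ X ∈ 𝒳, IsRConnected R X)
    (hsmall : Real.exp 1 * (Real.sqrt (ε * ((1 - θ) ^ (-(κ * γ / (2 * θ)))) ^ v) *
      Real.exp (2 * Real.sqrt (ε * ((1 - θ) ^ (-(κ * γ / (2 * θ)))) ^ v))) * ((Δ : ℝ) + 1) ^ 2 ≤ 1 / 2) :
    ‖polymerLogZ (GeomInc R)
        (pushforwardActivity (fun 𝒜 : Finset (Finset V) => 𝒜.biUnion id) (cellActivity (multivariateGaussian 0 Γ) f)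
          (rconnSubsets (Touches R) 𝒳))
        ((rconnSubsets (Touches R) 𝒳).image fun 𝒜 => 𝒜.biUnion id)‖ ≤
      (𝒳.biUnion id).card * ((Δ : ℝ) + 1) * (2 * (Real.exp 1 * (Real.sqrt (ε * ((1 - θ) ^ (-(κ * γ / (2 * θ)))) ^ v) *
        Real.exp (2 * Real.sqrt (ε * ((1 - θ) ^ (-(κ * γ / (2 * θ)))) ^ v))))) := by
  have hM := norm_setActivity_le_singletons hΓ hΓop hdiag hγ cell hdisj hv hε hκ hθ0 hθ1 hκθ hreg hsup (f := f)
  have hε' : 0 ≤ ε * ((1 - θ) ^ (-(κ * γ / (2 * θ)))) ^ v :=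
    mul_nonneg hε (pow_nonneg (zero_le_one.trans (one_le_regulatorCost (mul_nonneg hκ hγ) hθ0 hθ1)) _)
  exact norm_setLogZ_le hRsymm hΔ hnbr 𝒳 hconn hε' (fun 𝒜 _ => hM 𝒜) hsmall

end Gaussian

/-! ## §4. Toy -/

/-- Toy (§1): `ε′(0) = 0 ≥ 0`. -/
example : 0 ≤ Real.sqrt 0 * Real.exp (2 * Real.sqrt 0) := eps'_nonneg 0

end Summit.QuantumFields.BalabanUV.T4Continuum.NE7b.SupPolymerLocalExpansion
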